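import Literature.Analysis.FluidPDE.LerayPressureDecayProofs
import Literature.Analysis.FluidPDE.NewtonPotentialHolder
import HarnessLib

/-!
# The Kikuchi–Seregin pressure decay (Dp) from a slice oscillation estimate of the pressure
(Kang–Miura–Tsai 2021, Lemmas 3.3–3.4 and App. 1; Kikuchi–Seregin 2007, Lemma 2.2)

Analysis/FluidPDE proof file (theorems only) in the decomposition of the named fact **D**
`Literature.Analysis.FluidPDE.leray_solution_ckn_decay` (`LerayFarFieldEpsilonRegularity.lean`),
through its pressure part **Dp** `Literature.Analysis.FluidPDE.leray_solution_pressure_decay`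
(`LerayPressureDecay.lean`): for a local Leray solution `(v, π)` (Kang–Miura–Tsai Def. 3.2, the
tree's `IsLocalLeraySolution`) with `L³` datum there are gauges `c_{x₀} ∈ L^{3/2}(0, T)` with
`∫₀ᵀ ∫_{B(x₀,3/2)} |π - c_{x₀}(t)|^{3/2} → 0` as `|x₀| → ∞`.

In print (Kang–Miura–Tsai, IMRN 2021 = arXiv:1812.10509, App. 1, proof of Lemma 3.4, p. 18)
the gauged pressure on a ball `B_R(x₀)` splits as `π - c_{x₀,R}(t) = p_loc + p_far` with
"By the Calderon–Zygmund estimate, `∫_{B_{3R/2}(x₀)} |p_loc|^q ≤ c_q ∫_{B_{3R}(x₀)} |v|^{2q}`"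
and "For `p_far` we have a pointwise bound
`|p_far(x,t)| ≤ ∫_{2R<|y-x₀|} cR |x₀-y|⁻⁴ |v(y,t)|² dy`". This file isolates exactly what the
decay **Dp** needs from that analysis — a **slice oscillation estimate** of the pressure in the
mean gauge,

  (Osc) for a.e. `t > 0` and every centre `x₁`:
  `‖π(t) - ⨍_{B(x₁,3/2)} π(t)‖_{L^{3/2}(B(x₁,3/2))}
     ≤ C ‖v(t)‖²_{L³(B(x₁,11/2))} + C ∫_{|y-x₁| ≥ 3/2} |v(t,y)|² |y-x₁|⁻⁴ dy`,

and **proves Dp (hence D) from (Osc)** (`leray_solution_pressure_decay_of_oscillation`,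
`leray_solution_ckn_decay_of_oscillation`), with the explicit gauge
`c_{x₀}(t) = ⨍_{B(x₀,3/2)} π(t, y) dy`. The proof of (Osc) itself (the pressure decomposition of
Lemma 3.4, a Liouville argument) is the object of the sibling files of this decomposition; here
(Osc) is a hypothesis, so nothing is asserted.

Relation to `LerayPressureDecayProofs.lean` (the route **PD → CZ → Dp** through the named facts
`kangMiuraTsai_pressure_decomposition` and `stein1970_normalisedPressure_ae_Lp_bound` of
`LocalLerayPressureDecomposition.lean`): that route transcribes the printed expansion with the
pointwise principal-value near field `normalisedPressure (1_{B_{2r}(x₀)} v(t))` of the rough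
slice, and therefore needs Stein's a.e. theory (Ch. II Thm. 4) on the `L^p` class. The present
route asks only for (Osc), an `L^{3/2}(B)`-estimate modulo constants, which follows from the
expansion in any weak form (duality against mean-zero test functions) and needs the
Calderón–Zygmund bound only on smooth compactly supported densities (proved in the tree,
`NormalisedPressureLpBoundProofs.lean`). Both routes end in the same named fact **Dp**.

## Contents (all proved)

* Far-field tails of uniformly locally bounded densities (`exists_farField_tail_le`): if
  `∫_{B(z,r)} f ≤ C` for all `z` then `∫_{|y-x₁| ≥ L} f(y)|y-x₁|⁻⁴ dy ≤ K(r) (L-r)⁻¹ C` for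
  `L ≥ 2r` — by smearing the weight over `B(y, r)`, Tonelli, and
  `∫_{|z| ≥ ρ} |z|⁻⁴ dz = 3|B₁|/ρ` (`NewtonPotentialHolder.lintegral_compl_ball_norm_rpow_neg`).
  This replaces the lattice sum `∑_{k ≠ 0} |Rk|⁻⁴ ∫_{B_R(x₀+Rk)} |v|²` of the printed bound.
* The far field of a local Leray solution (`IsLocalLeraySolution.farField_setup`,
  `.tendsto_lintegral_farField`, `.tendsto_lintegral_farField_rpow`): with the uniformly local
  energy bound (2) and the decay (7) of Def. 3.2,
  `∫₀ᵀ (∫_{|y-x₁| ≥ R} |v(t,y)|²|y-x₁|⁻⁴ dy)^{3/2} dt → 0` as `|x₁| → ∞`.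
* The mean gauge (`IsLocalLeraySolution.memLp_setAverage_pressure`): `t ↦ ⨍_{B(x₁,r)} π(t)` is
  in `L^{3/2}(0, T)` (Fubini measurability; Hölder on the ball; `π ∈ L^{3/2}_loc` up to `t = 0`).
* The reduction (`leray_solution_pressure_decay_of_oscillation`): Tonelli on
  `(0,T) × B(x₀,3/2)`, (Osc) slice-wise, `(a+b)^{3/2} ≤ 2^{1/2}(a^{3/2}+b^{3/2})`, and the two
  decays — of `∫₀ᵀ∫_{B(x₀,11/2)} |v|³` (`IsLocalLeraySolution.tendsto_lintegral_cube_cocompact`,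
  `LerayVelocityCubicDecay.lean`) and of the far field.

## Mathlib / tree search

Tree: `leray_solution_pressure_decay`, `leray_solution_ckn_decay_of_pressure_decay`
(`LerayPressureDecay.lean`), `IsLocalLeraySolution.tendsto_lintegral_cube_cocompact`,
`NewtonPotentialHolder.lintegral_compl_ball_norm_rpow_neg`, `.lintegral_compl_ball_comp_sub_left`.
Mathlib: `lintegral_lintegral_swap`, `lintegral_prod`, `Measure.prod_restrict`,
`AEStronglyMeasurable.integral_prod_right'`, `AEStronglyMeasurable.prodMk_left`,
`eLpNorm_le_eLpNorm_mul_rpow_measure_univ`, `eLpNorm_nnreal_pow_eq_lintegral`,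
`ENNReal.rpow_add_le_mul_rpow_add_rpow`, `ENNReal.tendsto_nhds_zero`, `Measure.addHaar_ball_center`.

## References

* K. Kang, H. Miura, T.-P. Tsai, *Short time regularity of Navier–Stokes flows with locally `L³`
  initial data and applications*, IMRN 2021 = arXiv:1812.10509, §3 Def. 3.2, Lemma 3.3
  (= Kikuchi–Seregin Lemma 2.2, the `δ_R` term), Lemma 3.4 and its proof, App. 1 p. 18 (the
  Calderón–Zygmund and far-field bounds). Bib key `KangMiuraTsai2020`.
* N. Kikuchi, G. Seregin, AMS Transl. (2) 220 (2007), Lemma 2.2. Bib key `KikuchiSeregin2007`.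
-/

noncomputable section

open _root_.MeasureTheory _root_.TopologicalSpace _root_.Metric _root_.Filter _root_.Set
  _root_.Function
open scoped _root_.ENNReal _root_.NNReal _root_.Topology

namespace Literature.Analysis.FluidPDE

/-! ## Far-field tails of uniformly locally bounded densities -/

/-- The far-field weight `|y - x₁|⁻⁴` written with a real power: `(‖z‖ ^ 4)⁻¹ = ‖z‖ ^ (-4)`
(both sides are `0` at `z = 0`). [folklore] -/
theorem inv_norm_pow_four_eq_rpow (z : (EuclideanSpace ℝ (Fin 3))) : (‖z‖ ^ 4)⁻¹ = ‖z‖ ^ (-(4 : ℝ)) := by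
  rw [Real.rpow_neg (norm_nonneg z), show (4 : ℝ) = ((4 : ℕ) : ℝ) by norm_num,
    Real.rpow_natCast]

/-- **Smearing the weight over a small ball.** If `0 < r`, `2r ≤ L ≤ |y - x₁|`, then for every
`y' ∈ B(y, r)` one has `|y' - x₁| ≤ (3/2)|y - x₁|`, whence
`|y - x₁|⁻⁴ · vol B(y, r) ≤ (3/2)⁴ ∫_{B(y, r)} |y' - x₁|⁻⁴ dy'`. [folklore] -/
theorem ofReal_inv_norm_pow_four_mul_volume_ball_le {r L : ℝ} (hr : 0 < r) (hL : 2 * r ≤ L)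
    {x₁ y : (EuclideanSpace ℝ (Fin 3))} (hy : L ≤ ‖y - x₁‖) :
    ENNReal.ofReal ((‖y - x₁‖ ^ 4)⁻¹) * volume (ball y r) ≤
      ENNReal.ofReal ((3 / 2 : ℝ) ^ 4) *
        ∫⁻ y' in ball y r, ENNReal.ofReal ((‖y' - x₁‖ ^ 4)⁻¹) := by
  have hyx : 0 < ‖y - x₁‖ := by linarith
  have hpt : ∀ y' ∈ ball y r, ENNReal.ofReal ((‖y - x₁‖ ^ 4)⁻¹) ≤
      ENNReal.ofReal ((3 / 2 : ℝ) ^ 4) * ENNReal.ofReal ((‖y' - x₁‖ ^ 4)⁻¹) := by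
    intro y' hy'
    rw [mem_ball, dist_eq_norm] at hy'
    have h1 : ‖y' - x₁‖ ≤ 3 / 2 * ‖y - x₁‖ := by
      have := norm_add_le (y' - y) (y - x₁)
      rw [sub_add_sub_cancel] at this
      linarith
    have h2 : 0 < ‖y' - x₁‖ := by
      have := norm_sub_norm_le (y - x₁) (y - y')
      rw [sub_sub_sub_cancel_left, norm_sub_rev y y'] at this
      linarith
    have h3 : ‖y' - x₁‖ ^ 4 ≤ (3 / 2 : ℝ) ^ 4 * ‖y - x₁‖ ^ 4 := by
      rw [← mul_pow]
      exact pow_le_pow_left₀ (norm_nonneg _) h1 4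
    rw [← ENNReal.ofReal_mul (by positivity)]
    refine ENNReal.ofReal_le_ofReal ?_
    have h4 : 0 < ‖y' - x₁‖ ^ 4 := by positivity
    calc (‖y - x₁‖ ^ 4)⁻¹ = (3 / 2 : ℝ) ^ 4 * ((3 / 2 : ℝ) ^ 4 * ‖y - x₁‖ ^ 4)⁻¹ := by
          field_simp
      _ ≤ (3 / 2 : ℝ) ^ 4 * (‖y' - x₁‖ ^ 4)⁻¹ :=
          mul_le_mul_of_nonneg_left (inv_anti₀ h4 h3) (by positivity)
  calc ENNReal.ofReal ((‖y - x₁‖ ^ 4)⁻¹) * volume (ball y r)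
      = ∫⁻ _ in ball y r, ENNReal.ofReal ((‖y - x₁‖ ^ 4)⁻¹) := by rw [setLIntegral_const]
    _ ≤ ∫⁻ y' in ball y r,
          ENNReal.ofReal ((3 / 2 : ℝ) ^ 4) * ENNReal.ofReal ((‖y' - x₁‖ ^ 4)⁻¹) :=
        setLIntegral_mono' measurableSet_ball hpt
    _ = _ := by rw [lintegral_const_mul' _ _ ENNReal.ofReal_ne_top]

/-- The weight `y ↦ |y - x₁|⁻⁴` is measurable. [folklore] -/
theorem measurable_ofReal_inv_norm_pow_four (x₁ : (EuclideanSpace ℝ (Fin 3))) :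
    Measurable fun y : (EuclideanSpace ℝ (Fin 3)) => ENNReal.ofReal ((‖y - x₁‖ ^ 4)⁻¹) :=
  ((continuous_norm.comp (continuous_id.sub continuous_const)).pow 4).measurable.inv.ennreal_ofReal

/-- **The integral of the weight off a ball**: `∫_{|y - x₁| ≥ ρ} |y - x₁|⁻⁴ dy = 3 |B₁| / ρ`
(polar coordinates; `NewtonPotentialHolder.lintegral_compl_ball_norm_rpow_neg`). [folklore] -/
theorem lintegral_compl_ball_ofReal_inv_norm_pow_four (x₁ : (EuclideanSpace ℝ (Fin 3))) {ρ : ℝ} (hρ : 0 < ρ) :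
    ∫⁻ y in (ball x₁ ρ)ᶜ, ENNReal.ofReal ((‖y - x₁‖ ^ 4)⁻¹) =
      ENNReal.ofReal (3 * (volume : Measure (EuclideanSpace ℝ (Fin 3))).real (ball 0 1) * ρ⁻¹) := by
  have h1 : (fun y : (EuclideanSpace ℝ (Fin 3)) => ENNReal.ofReal ((‖y - x₁‖ ^ 4)⁻¹)) =
      fun y => (fun z : (EuclideanSpace ℝ (Fin 3)) => ENNReal.ofReal (‖z‖ ^ (-(4 : ℝ)))) (x₁ - y) := by
    funext y
    rw [inv_norm_pow_four_eq_rpow, norm_sub_rev]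
  rw [h1, NewtonPotentialHolder.lintegral_compl_ball_comp_sub_left
    (fun z : (EuclideanSpace ℝ (Fin 3)) => ENNReal.ofReal (‖z‖ ^ (-(4 : ℝ)))) x₁ ρ,
    NewtonPotentialHolder.lintegral_compl_ball_norm_rpow_neg (by norm_num) hρ]
  congr 1
  rw [show (3 : ℝ) - 4 = -1 by norm_num, Real.rpow_neg_one]
  norm_num

/-- **Far-field tails of a uniformly locally bounded density.** For every radius `r > 0` there
is a finite constant `K = K(r)` such that: if `f ≥ 0` is a.e.-measurable on `ℝ³` with
`∫_{B(z, r)} f ≤ C` for every centre `z`, then for every `x₁` and every `L ≥ 2r`,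
`∫_{|y - x₁| ≥ L} f(y) |y - x₁|⁻⁴ dy ≤ K · (L - r)⁻¹ · C`.
Proof: smear the weight over `B(y, r)` (`|y - x₁|⁻⁴ ≤ (3/2)⁴ |B_r|⁻¹ ∫_{B(y,r)} |y' - x₁|⁻⁴`),
exchange the order of integration (Tonelli), bound the inner integral `∫_{B(y', r)} f ≤ C` on
`|y' - x₁| ≥ L - r`, and integrate the weight, `∫_{|y'-x₁| ≥ L-r} |y' - x₁|⁻⁴ = 3|B₁|/(L - r)`.
[folklore] -/
theorem exists_farField_tail_le {r : ℝ} (hr : 0 < r) :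
    ∃ K : ℝ≥0∞, K ≠ ∞ ∧ ∀ (f : (EuclideanSpace ℝ (Fin 3)) → ℝ≥0∞), AEMeasurable f volume → ∀ C : ℝ≥0∞,
      (∀ z : (EuclideanSpace ℝ (Fin 3)), ∫⁻ y in ball z r, f y ≤ C) → ∀ (x₁ : (EuclideanSpace ℝ (Fin 3))) (L : ℝ), 2 * r ≤ L →
        ∫⁻ y in (ball x₁ L)ᶜ, f y * ENNReal.ofReal ((‖y - x₁‖ ^ 4)⁻¹) ≤
          K * ENNReal.ofReal ((L - r)⁻¹) * C := by
  set V : ℝ≥0∞ := volume (ball (0 : (EuclideanSpace ℝ (Fin 3))) r) with hV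
  have hV0 : V ≠ 0 := (measure_ball_pos volume (0 : (EuclideanSpace ℝ (Fin 3))) hr).ne'
  have hVtop : V ≠ ∞ := measure_ball_lt_top.ne
  set c4 : ℝ≥0∞ := ENNReal.ofReal ((3 / 2 : ℝ) ^ 4) with hc4
  set K : ℝ≥0∞ := c4 * V⁻¹ * ENNReal.ofReal (3 * (volume : Measure (EuclideanSpace ℝ (Fin 3))).real (ball 0 1))
    with hK
  refine ⟨K, ?_, fun f hf C hC x₁ L hL => ?_⟩
  · exact ENNReal.mul_ne_top (ENNReal.mul_ne_top ENNReal.ofReal_ne_top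
      (ENNReal.inv_ne_top.2 hV0)) ENNReal.ofReal_ne_top
  have hLr : 0 < L - r := by linarith
  set w : (EuclideanSpace ℝ (Fin 3)) → ℝ≥0∞ := fun y => ENNReal.ofReal ((‖y - x₁‖ ^ 4)⁻¹) with hw
  have hwm : Measurable w := measurable_ofReal_inv_norm_pow_four x₁
  -- Step 1: smear the weight
  have hsmear : ∀ y ∈ (ball x₁ L)ᶜ, w y ≤ V⁻¹ * (c4 * ∫⁻ y' in ball y r, w y') := by
    intro y hy
    rw [mem_compl_iff, mem_ball, dist_eq_norm, not_lt] at hy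
    have h := ofReal_inv_norm_pow_four_mul_volume_ball_le hr hL hy
    rw [Measure.addHaar_ball_center volume y r, ← hV] at h
    calc w y = V⁻¹ * (w y * V) := by
          rw [mul_comm (w y) V, ← mul_assoc, ENNReal.inv_mul_cancel hV0 hVtop, one_mul]
      _ ≤ V⁻¹ * (c4 * ∫⁻ y' in ball y r, w y') := by gcongr
  -- Step 2: the exchange of integrations
  set S : Set ((EuclideanSpace ℝ (Fin 3)) × (EuclideanSpace ℝ (Fin 3))) := {p | L ≤ dist p.1 x₁ ∧ dist p.2 p.1 < r} with hS
  have hSm : MeasurableSet S := by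
    refine (isClosed_le continuous_const (continuous_fst.dist continuous_const)).measurableSet.inter
      ?_
    exact (isOpen_lt (continuous_snd.dist continuous_fst) continuous_const).measurableSet
  set G : (EuclideanSpace ℝ (Fin 3)) × (EuclideanSpace ℝ (Fin 3)) → ℝ≥0∞ := fun p => f p.1 * w p.2 with hG
  have hGm : AEMeasurable G ((volume : Measure (EuclideanSpace ℝ (Fin 3))).prod (volume : Measure (EuclideanSpace ℝ (Fin 3)))) :=
    hf.comp_fst.mul (hwm.comp measurable_snd).aemeasurable
  have hHm : AEMeasurable (uncurry fun y y' => S.indicator G (y, y'))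
      ((volume : Measure (EuclideanSpace ℝ (Fin 3))).prod (volume : Measure (EuclideanSpace ℝ (Fin 3)))) := hGm.indicator hSm
  -- the iterated integral in the order `y` then `y'`
  have hI1 : ∫⁻ y in (ball x₁ L)ᶜ, f y * ∫⁻ y' in ball y r, w y' =
      ∫⁻ y, ∫⁻ y', S.indicator G (y, y') := by
    rw [← lintegral_indicator measurableSet_ball.compl]
    refine lintegral_congr fun y => ?_
    by_cases hy : y ∈ (ball x₁ L)ᶜ
    · rw [indicator_of_mem hy, ← lintegral_const_mul'' _ hwm.aemeasurable,
        ← lintegral_indicator measurableSet_ball]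
      refine lintegral_congr fun y' => ?_
      rw [mem_compl_iff, mem_ball, not_lt] at hy
      by_cases hy' : y' ∈ ball y r
      · have hmem : (y, y') ∈ S := ⟨hy, mem_ball.1 hy'⟩
        rw [indicator_of_mem hy', indicator_of_mem hmem]
      · have hnmem : (y, y') ∉ S := fun h => hy' (mem_ball.2 h.2)
        rw [indicator_of_notMem hy', indicator_of_notMem hnmem]
    · rw [indicator_of_notMem hy]
      have h0 : ∀ y', S.indicator G (y, y') = 0 := fun y' =>
        indicator_of_notMem (fun h => hy (by
          rw [mem_compl_iff, mem_ball, not_lt]; exact h.1)) _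
      simp [h0]
  -- the inner integral in the order `y'` then `y`
  have hinner : ∀ y', ∫⁻ y, S.indicator G (y, y') ≤
      (ball x₁ (L - r))ᶜ.indicator (fun y' => C * w y') y' := by
    intro y'
    by_cases hy' : y' ∈ (ball x₁ (L - r))ᶜ
    · rw [indicator_of_mem hy']
      calc ∫⁻ y, S.indicator G (y, y')
          ≤ ∫⁻ y, (ball y' r).indicator (fun y => f y * w y') y := by
            refine lintegral_mono fun y => ?_
            by_cases hyS : (y, y') ∈ S
            · have hyb : y ∈ ball y' r := by
                rw [mem_ball, dist_comm]; exact hyS.2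
              rw [indicator_of_mem hyS, indicator_of_mem hyb]
            · rw [indicator_of_notMem hyS]; exact zero_le
        _ = (∫⁻ y in ball y' r, f y) * w y' := by
            rw [lintegral_indicator measurableSet_ball, lintegral_mul_const'' _ hf.restrict]
        _ ≤ C * w y' := by gcongr; exact hC y'
    · rw [indicator_of_notMem hy']
      rw [mem_compl_iff, not_not, mem_ball] at hy'
      have h0 : ∀ y, S.indicator G (y, y') = 0 := by
        intro y
        refine indicator_of_notMem (fun h => ?_) _
        have : dist y x₁ ≤ dist y y' + dist y' x₁ := dist_triangle _ _ _
        rw [dist_comm y y'] at this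
        linarith [h.1, h.2]
      simp [h0]
  have hI2 : ∫⁻ y in (ball x₁ L)ᶜ, f y * ∫⁻ y' in ball y r, w y' ≤
      C * ∫⁻ y' in (ball x₁ (L - r))ᶜ, w y' := by
    rw [hI1, lintegral_lintegral_swap hHm]
    calc ∫⁻ y', ∫⁻ y, S.indicator G (y, y')
        ≤ ∫⁻ y', (ball x₁ (L - r))ᶜ.indicator (fun y' => C * w y') y' := lintegral_mono hinner
      _ = C * ∫⁻ y' in (ball x₁ (L - r))ᶜ, w y' := by
          rw [lintegral_indicator measurableSet_ball.compl, lintegral_const_mul'' _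
            hwm.aemeasurable.restrict]
  -- Step 3: assemble
  have hKne : V⁻¹ * c4 ≠ ∞ := ENNReal.mul_ne_top (ENNReal.inv_ne_top.2 hV0) ENNReal.ofReal_ne_top
  calc ∫⁻ y in (ball x₁ L)ᶜ, f y * w y
      ≤ ∫⁻ y in (ball x₁ L)ᶜ, f y * (V⁻¹ * (c4 * ∫⁻ y' in ball y r, w y')) :=
        setLIntegral_mono' measurableSet_ball.compl fun y hy => by gcongr; exact hsmear y hy
    _ = V⁻¹ * c4 * ∫⁻ y in (ball x₁ L)ᶜ, f y * ∫⁻ y' in ball y r, w y' := by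
        rw [← lintegral_const_mul' _ _ hKne]
        refine lintegral_congr fun y => ?_
        ring
    _ ≤ V⁻¹ * c4 * (C * ∫⁻ y' in (ball x₁ (L - r))ᶜ, w y') := by gcongr
    _ = V⁻¹ * c4 * (C * ENNReal.ofReal (3 * (volume : Measure (EuclideanSpace ℝ (Fin 3))).real (ball 0 1) * (L - r)⁻¹)) := by
        rw [lintegral_compl_ball_ofReal_inv_norm_pow_four x₁ hLr]
    _ = K * ENNReal.ofReal ((L - r)⁻¹) * C := by
        rw [hK, ENNReal.ofReal_mul (by positivity)]
        ring

/-! ## The far field of a local Leray solution -/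

section FarField

variable {ν : ℝ} {u₀ : (EuclideanSpace ℝ (Fin 3)) → (EuclideanSpace ℝ (Fin 3))} {v : ℝ → (EuclideanSpace ℝ (Fin 3)) → (EuclideanSpace ℝ (Fin 3))} {π : ℝ → (EuclideanSpace ℝ (Fin 3)) → ℝ}

/-- A local Leray solution is a.e.-strongly measurable on the boxes `(0, T) × s`. [folklore] -/
theorem IsLocalLeraySolution.aestronglyMeasurable_box (hv : IsLocalLeraySolution ν u₀ v π)
    (T : ℝ) (s : Set (EuclideanSpace ℝ (Fin 3))) :
    AEStronglyMeasurable (uncurry v)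
      ((volume.restrict (Ioo (0 : ℝ) T)).prod (volume.restrict s)) := by
  rw [Measure.prod_restrict, ← Measure.volume_eq_prod]
  exact hv.aestronglyMeasurable.mono_measure
    (Measure.restrict_mono (Set.prod_mono Ioo_subset_Ioi_self (subset_univ _)) le_rfl)

/-- Tonelli on a box: `∫₀ᵀ ∫_s |v(t)|² dy dt = ∫∫_{(0,T) × s} |v|²`. [folklore] -/
theorem IsLocalLeraySolution.lintegral_lintegral_sq_eq (hv : IsLocalLeraySolution ν u₀ v π)
    (T : ℝ) (s : Set (EuclideanSpace ℝ (Fin 3))) :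
    ∫⁻ t in Ioo 0 T, ∫⁻ y in s, ‖v t y‖ₑ ^ 2 = ∫⁻ z in Ioo 0 T ×ˢ s, ‖v z.1 z.2‖ₑ ^ 2 := by
  have hprod : (volume.restrict (Ioo (0 : ℝ) T)).prod (volume.restrict s) =
      volume.restrict (Ioo 0 T ×ˢ s) := by
    rw [Measure.prod_restrict, ← Measure.volume_eq_prod]
  have hF : AEMeasurable (fun z : ℝ × (EuclideanSpace ℝ (Fin 3)) => ‖v z.1 z.2‖ₑ ^ 2)
      ((volume.restrict (Ioo (0 : ℝ) T)).prod (volume.restrict s)) :=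
    (hv.aestronglyMeasurable_box T s).enorm.pow_const _
  rw [← hprod, lintegral_prod _ hF]

/-- **Set-up for the far field.** For a local Leray solution, radii `R > 0` and times
`T > 0` there are finite constants `K`, `C₁` such that for a.e. `t ∈ (0, T)`, every centre
`x₁` and every `L ≥ R`,
`∫_{|y - x₁| ≥ L} |v(t,y)|² |y - x₁|⁻⁴ dy ≤ K (L - R/2)⁻¹ C₁`
(the uniformly local energy bound of Def. 3.2 (2) at a radius `ρ₀ ≥ max(R, √T)` fed into
`exists_farField_tail_le` at radius `R/2`). [folklore] -/
theorem IsLocalLeraySolution.farField_setup (hv : IsLocalLeraySolution ν u₀ v π) {R T : ℝ}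
    (hR : 0 < R) (hT : 0 < T) :
    ∃ (K : ℝ≥0∞) (C₁ : ℝ≥0), K ≠ ∞ ∧
      ∀ᵐ t ∂(volume.restrict (Ioo (0 : ℝ) T)), ∀ (x₁ : (EuclideanSpace ℝ (Fin 3))) (L : ℝ), R ≤ L →
        ∫⁻ y in (ball x₁ L)ᶜ, ‖v t y‖ₑ ^ 2 * ENNReal.ofReal ((‖y - x₁‖ ^ 4)⁻¹) ≤
          K * ENNReal.ofReal ((L - R / 2)⁻¹) * C₁ := by
  obtain ⟨K, hK, hKb⟩ := exists_farField_tail_le (half_pos hR)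
  set ρ₀ : ℝ := max R (T + 1) with hρ₀
  have hρ₀pos : 0 < ρ₀ := lt_of_lt_of_le hR (le_max_left _ _)
  have hRρ₀ : R / 2 ≤ ρ₀ := by linarith [le_max_left R (T + 1)]
  have hTρ₀ : T ≤ ρ₀ ^ 2 := by
    have h1 : T + 1 ≤ ρ₀ := le_max_right _ _
    nlinarith
  obtain ⟨C₁, hC₁⟩ := hv.uniformLocalEnergy ρ₀ hρ₀pos
  refine ⟨K, C₁, hK, ?_⟩
  have h1 := ae_restrict_of_ae_restrict_of_subset (Ioo_subset_Ioo le_rfl hTρ₀) hC₁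
  filter_upwards [h1, hv.ae_aestronglyMeasurable_slice T] with t ht htm x₁ L hL
  have h2 := hKb (fun y => ‖v t y‖ₑ ^ 2) (htm.enorm.pow_const _) C₁ (fun z =>
    (lintegral_mono_set (ball_subset_ball hRρ₀)).trans (ht z)) x₁ L (by linarith)
  exact h2

/-- **Decay of the time-integrated far field at spatial infinity.** For a local Leray solution,
`R > 0` and `T > 0`, `∫₀ᵀ ∫_{|y - x₁| ≥ R} |v(t,y)|² |y - x₁|⁻⁴ dy dt → 0` as `|x₁| → ∞`:
split the far region at a radius `L ≥ R`; the near part is at most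
`R⁻⁴ ∫₀ᵀ∫_{B(x₁, L)} |v|² → 0` by the decay (7) of Def. 3.2, and the tail is at most
`T K (L - R/2)⁻¹ C₁`, small for `L` large uniformly in `x₁` (`farField_setup`). [folklore] -/
theorem IsLocalLeraySolution.tendsto_lintegral_farField (hv : IsLocalLeraySolution ν u₀ v π)
    {R T : ℝ} (hR : 0 < R) (hT : 0 < T) :
    Tendsto (fun x₁ : (EuclideanSpace ℝ (Fin 3)) => ∫⁻ t in Ioo 0 T, ∫⁻ y in (ball x₁ R)ᶜ,
        ‖v t y‖ₑ ^ 2 * ENNReal.ofReal ((‖y - x₁‖ ^ 4)⁻¹)) (cocompact (EuclideanSpace ℝ (Fin 3))) (𝓝 0) := by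
  obtain ⟨K, C₁, hK, hae⟩ := hv.farField_setup hR hT
  set μt : Measure ℝ := volume.restrict (Ioo (0 : ℝ) T) with hμt
  have hμtu : μt univ = ENNReal.ofReal T := by
    rw [hμt, Measure.restrict_apply_univ, Real.volume_Ioo, sub_zero]
  -- the near part tends to zero for every `L`
  have hnear : ∀ L : ℝ, R ≤ L → Tendsto (fun x₁ : (EuclideanSpace ℝ (Fin 3)) =>
      ∫⁻ z in Ioo 0 T ×ˢ ball x₁ L, ‖v z.1 z.2‖ₑ ^ 2) (cocompact (EuclideanSpace ℝ (Fin 3))) (𝓝 0) := by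
    intro L hL
    set ρ : ℝ := max L (T + 1) with hρ
    have hρpos : 0 < ρ := lt_of_lt_of_le (hR.trans_le hL) (le_max_left _ _)
    have hLρ : L ≤ ρ := le_max_left _ _
    have hTρ : T ≤ ρ ^ 2 := by
      have h1 : T + 1 ≤ ρ := le_max_right _ _
      nlinarith
    exact tendsto_of_tendsto_of_tendsto_of_le_of_le tendsto_const_nhds (hv.decay ρ hρpos)
      (fun _ => zero_le) fun x₁ => lintegral_mono_set
        (Set.prod_mono (Ioo_subset_Ioo le_rfl hTρ) (ball_subset_ball hLρ))
  -- the splitting of the far field at radius `L`, a.e. in `t`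
  have hsplit : ∀ (x₁ : (EuclideanSpace ℝ (Fin 3))) (L : ℝ), R ≤ L → ∀ᵐ t ∂μt,
      ∫⁻ y in (ball x₁ R)ᶜ, ‖v t y‖ₑ ^ 2 * ENNReal.ofReal ((‖y - x₁‖ ^ 4)⁻¹) ≤
        (∫⁻ y in ball x₁ L, ‖v t y‖ₑ ^ 2) * ENNReal.ofReal ((R ^ 4)⁻¹) +
          K * ENNReal.ofReal ((L - R / 2)⁻¹) * C₁ := by
    intro x₁ L hL
    filter_upwards [hae] with t ht
    have hsub : (ball x₁ R)ᶜ ⊆ ((ball x₁ R)ᶜ ∩ ball x₁ L) ∪ (ball x₁ L)ᶜ := by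
      intro y hy
      by_cases hyL : y ∈ ball x₁ L
      · exact Or.inl ⟨hy, hyL⟩
      · exact Or.inr hyL
    have hw : ∀ y ∈ (ball x₁ R)ᶜ ∩ ball x₁ L,
        ‖v t y‖ₑ ^ 2 * ENNReal.ofReal ((‖y - x₁‖ ^ 4)⁻¹) ≤
          ‖v t y‖ₑ ^ 2 * ENNReal.ofReal ((R ^ 4)⁻¹) := by
      intro y hy
      have hy1 : R ≤ ‖y - x₁‖ := by
        have := hy.1
        rw [mem_compl_iff, mem_ball, dist_eq_norm, not_lt] at this
        exact this
      have h4 : (‖y - x₁‖ ^ 4)⁻¹ ≤ (R ^ 4)⁻¹ :=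
        inv_anti₀ (by positivity) (pow_le_pow_left₀ hR.le hy1 4)
      gcongr
    calc ∫⁻ y in (ball x₁ R)ᶜ, ‖v t y‖ₑ ^ 2 * ENNReal.ofReal ((‖y - x₁‖ ^ 4)⁻¹)
        ≤ ∫⁻ y in ((ball x₁ R)ᶜ ∩ ball x₁ L) ∪ (ball x₁ L)ᶜ,
            ‖v t y‖ₑ ^ 2 * ENNReal.ofReal ((‖y - x₁‖ ^ 4)⁻¹) := lintegral_mono_set hsub
      _ ≤ (∫⁻ y in (ball x₁ R)ᶜ ∩ ball x₁ L,
            ‖v t y‖ₑ ^ 2 * ENNReal.ofReal ((‖y - x₁‖ ^ 4)⁻¹)) +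
            ∫⁻ y in (ball x₁ L)ᶜ, ‖v t y‖ₑ ^ 2 * ENNReal.ofReal ((‖y - x₁‖ ^ 4)⁻¹) :=
          lintegral_union_le _ _ _
      _ ≤ (∫⁻ y in (ball x₁ R)ᶜ ∩ ball x₁ L, ‖v t y‖ₑ ^ 2 * ENNReal.ofReal ((R ^ 4)⁻¹)) +
            K * ENNReal.ofReal ((L - R / 2)⁻¹) * C₁ :=
          add_le_add (setLIntegral_mono' (measurableSet_ball.compl.inter measurableSet_ball) hw)
            (ht x₁ L hL)
      _ ≤ (∫⁻ y in ball x₁ L, ‖v t y‖ₑ ^ 2 * ENNReal.ofReal ((R ^ 4)⁻¹)) +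
            K * ENNReal.ofReal ((L - R / 2)⁻¹) * C₁ := by
          exact add_le_add (lintegral_mono_set inter_subset_right) le_rfl
      _ = _ := by rw [lintegral_mul_const' _ _ ENNReal.ofReal_ne_top]
  -- integration in time
  have hint : ∀ (x₁ : (EuclideanSpace ℝ (Fin 3))) (L : ℝ), R ≤ L →
      ∫⁻ t in Ioo 0 T, ∫⁻ y in (ball x₁ R)ᶜ, ‖v t y‖ₑ ^ 2 * ENNReal.ofReal ((‖y - x₁‖ ^ 4)⁻¹) ≤
        (∫⁻ z in Ioo 0 T ×ˢ ball x₁ L, ‖v z.1 z.2‖ₑ ^ 2) * ENNReal.ofReal ((R ^ 4)⁻¹) +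
          K * ENNReal.ofReal ((L - R / 2)⁻¹) * C₁ * ENNReal.ofReal T := by
    intro x₁ L hL
    calc ∫⁻ t in Ioo 0 T, ∫⁻ y in (ball x₁ R)ᶜ,
          ‖v t y‖ₑ ^ 2 * ENNReal.ofReal ((‖y - x₁‖ ^ 4)⁻¹)
        ≤ ∫⁻ t in Ioo 0 T, ((∫⁻ y in ball x₁ L, ‖v t y‖ₑ ^ 2) * ENNReal.ofReal ((R ^ 4)⁻¹) +
            K * ENNReal.ofReal ((L - R / 2)⁻¹) * C₁) := lintegral_mono_ae (hsplit x₁ L hL)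
      _ = (∫⁻ t in Ioo 0 T, ∫⁻ y in ball x₁ L, ‖v t y‖ₑ ^ 2) * ENNReal.ofReal ((R ^ 4)⁻¹) +
            K * ENNReal.ofReal ((L - R / 2)⁻¹) * C₁ * ENNReal.ofReal T := by
          rw [lintegral_add_right _ measurable_const, lintegral_mul_const' _ _
            ENNReal.ofReal_ne_top, lintegral_const, hμtu]
      _ = _ := by rw [hv.lintegral_lintegral_sq_eq T (ball x₁ L)]
  -- the `ε`-argument
  refine ENNReal.tendsto_nhds_zero.2 fun ε hε => ?_
  set D : ℝ≥0∞ := K * C₁ * ENNReal.ofReal T with hD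
  have hDtop : D ≠ ∞ :=
    ENNReal.mul_ne_top (ENNReal.mul_ne_top hK ENNReal.coe_ne_top) ENNReal.ofReal_ne_top
  have hDL : Tendsto (fun L : ℝ => D * ENNReal.ofReal ((L - R / 2)⁻¹)) atTop (𝓝 0) := by
    have h1 : Tendsto (fun L : ℝ => (L - R / 2)⁻¹) atTop (𝓝 0) := by
      refine tendsto_inv_atTop_zero.comp ?_
      have := tendsto_atTop_add_const_right atTop (-(R / 2)) tendsto_id
      simpa [sub_eq_add_neg] using this
    have h2 := ENNReal.tendsto_ofReal h1
    rw [ENNReal.ofReal_zero] at h2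
    have h3 := ENNReal.Tendsto.const_mul h2 (Or.inr hDtop) (a := D)
    rwa [mul_zero] at h3
  have hε2 : 0 < ε / 2 := ENNReal.half_pos hε.ne'
  obtain ⟨L, hL1, hL2⟩ := (((tendsto_order.1 hDL).2 _ hε2).and (eventually_ge_atTop R)).exists
  have hnearL : Tendsto (fun x₁ : (EuclideanSpace ℝ (Fin 3)) =>
      (∫⁻ z in Ioo 0 T ×ˢ ball x₁ L, ‖v z.1 z.2‖ₑ ^ 2) * ENNReal.ofReal ((R ^ 4)⁻¹))
      (cocompact (EuclideanSpace ℝ (Fin 3))) (𝓝 0) := by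
    have := ENNReal.Tendsto.mul_const (hnear L hL2) (Or.inr ENNReal.ofReal_ne_top)
      (b := ENNReal.ofReal ((R ^ 4)⁻¹))
    rwa [zero_mul] at this
  filter_upwards [(tendsto_order.1 hnearL).2 _ hε2] with x₁ hx₁
  calc ∫⁻ t in Ioo 0 T, ∫⁻ y in (ball x₁ R)ᶜ, ‖v t y‖ₑ ^ 2 * ENNReal.ofReal ((‖y - x₁‖ ^ 4)⁻¹)
      ≤ (∫⁻ z in Ioo 0 T ×ˢ ball x₁ L, ‖v z.1 z.2‖ₑ ^ 2) * ENNReal.ofReal ((R ^ 4)⁻¹) +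
          K * ENNReal.ofReal ((L - R / 2)⁻¹) * C₁ * ENNReal.ofReal T := hint x₁ L hL2
    _ ≤ ε / 2 + ε / 2 := by
        refine add_le_add hx₁.le ?_
        have : K * ENNReal.ofReal ((L - R / 2)⁻¹) * C₁ * ENNReal.ofReal T =
            D * ENNReal.ofReal ((L - R / 2)⁻¹) := by rw [hD]; ring
        rw [this]
        exact hL1.le
    _ = ε := ENNReal.add_halves ε

/-- **Decay of `∫₀ᵀ (far field)^{3/2}` at spatial infinity.** For a local Leray solution,
`R > 0`, `T > 0`: `∫₀ᵀ (∫_{|y-x₁| ≥ R} |v(t,y)|² |y-x₁|⁻⁴ dy)^{3/2} dt → 0` as `|x₁| → ∞`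
(the far field is bounded by a constant `A` for a.e. `t`, uniformly in `x₁`, so
`∫₀ᵀ far^{3/2} ≤ A^{1/2} ∫₀ᵀ far → 0`). [folklore] -/
theorem IsLocalLeraySolution.tendsto_lintegral_farField_rpow
    (hv : IsLocalLeraySolution ν u₀ v π) {R T : ℝ} (hR : 0 < R) (hT : 0 < T) :
    Tendsto (fun x₁ : (EuclideanSpace ℝ (Fin 3)) => ∫⁻ t in Ioo 0 T, (∫⁻ y in (ball x₁ R)ᶜ,
        ‖v t y‖ₑ ^ 2 * ENNReal.ofReal ((‖y - x₁‖ ^ 4)⁻¹)) ^ (3 / 2 : ℝ)) (cocompact (EuclideanSpace ℝ (Fin 3))) (𝓝 0) := by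
  obtain ⟨K, C₁, hK, hae⟩ := hv.farField_setup hR hT
  set A : ℝ≥0∞ := K * ENNReal.ofReal ((R - R / 2)⁻¹) * C₁ with hA
  have hAtop : A ≠ ∞ :=
    ENNReal.mul_ne_top (ENNReal.mul_ne_top hK ENNReal.ofReal_ne_top) ENNReal.coe_ne_top
  have hA2 : A ^ (1 / 2 : ℝ) ≠ ∞ := ENNReal.rpow_ne_top_of_nonneg (by norm_num) hAtop
  have hkey : ∀ x₁ : (EuclideanSpace ℝ (Fin 3)), ∫⁻ t in Ioo 0 T, (∫⁻ y in (ball x₁ R)ᶜ,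
      ‖v t y‖ₑ ^ 2 * ENNReal.ofReal ((‖y - x₁‖ ^ 4)⁻¹)) ^ (3 / 2 : ℝ) ≤
      (∫⁻ t in Ioo 0 T, ∫⁻ y in (ball x₁ R)ᶜ,
        ‖v t y‖ₑ ^ 2 * ENNReal.ofReal ((‖y - x₁‖ ^ 4)⁻¹)) * A ^ (1 / 2 : ℝ) := by
    intro x₁
    rw [← lintegral_mul_const' _ _ hA2]
    refine lintegral_mono_ae ?_
    filter_upwards [hae] with t ht
    have hle := ht x₁ R le_rfl
    rw [show (3 / 2 : ℝ) = 1 + 1 / 2 by norm_num,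
      ENNReal.rpow_add_of_nonneg _ _ (by norm_num) (by norm_num), ENNReal.rpow_one]
    gcongr
  have h0 := ENNReal.Tendsto.mul_const (hv.tendsto_lintegral_farField hR hT) (Or.inr hA2)
    (b := A ^ (1 / 2 : ℝ))
  rw [zero_mul] at h0
  exact tendsto_of_tendsto_of_tendsto_of_le_of_le tendsto_const_nhds h0 (fun _ => zero_le) hkey

end FarField

/-! ## The mean gauge of the pressure and the reduction of Dp to the oscillation estimate -/

section Reduction

variable {ν : ℝ} {u₀ : (EuclideanSpace ℝ (Fin 3)) → (EuclideanSpace ℝ (Fin 3))} {v : ℝ → (EuclideanSpace ℝ (Fin 3)) → (EuclideanSpace ℝ (Fin 3))} {π : ℝ → (EuclideanSpace ℝ (Fin 3)) → ℝ}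

/-- `(3/2 : ℝ≥0∞).toReal = 3/2`. [folklore] -/
theorem ennreal_toReal_three_halves : (3 / 2 : ℝ≥0∞).toReal = 3 / 2 := by
  rw [ENNReal.toReal_div]
  norm_num

/-- `‖g‖_{L^{3/2}}^{3/2} = ∫ |g|^{3/2}`. [folklore] -/
theorem eLpNorm_rpow_three_halves_eq {α : Type*} [MeasurableSpace α] (μ : Measure α)
    {X : Type*} [NormedAddCommGroup X] (g : α → X) :
    eLpNorm g (3 / 2) μ ^ (3 / 2 : ℝ) = ∫⁻ x, ‖g x‖ₑ ^ (3 / 2 : ℝ) ∂μ := by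
  have h := eLpNorm_nnreal_pow_eq_lintegral (f := g) (μ := μ) (p := (3 / 2 : ℝ≥0)) (by norm_num)
  have hc : ((3 / 2 : ℝ≥0) : ℝ≥0∞) = 3 / 2 := by
    rw [ENNReal.coe_div (by norm_num)]; norm_num
  have hr : ((3 / 2 : ℝ≥0) : ℝ) = 3 / 2 := by norm_num
  rw [hc, hr] at h
  exact h

/-- `‖g‖_{L³}³ = ∫ |g|³`. [folklore] -/
theorem eLpNorm_rpow_three_eq {α : Type*} [MeasurableSpace α] (μ : Measure α)
    {X : Type*} [NormedAddCommGroup X] (g : α → X) :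
    eLpNorm g 3 μ ^ (3 : ℝ) = ∫⁻ x, ‖g x‖ₑ ^ (3 : ℕ) ∂μ := by
  have h := eLpNorm_nnreal_pow_eq_lintegral (f := g) (μ := μ) (p := (3 : ℝ≥0)) (by norm_num)
  have hc : ((3 : ℝ≥0) : ℝ≥0∞) = 3 := by norm_num
  have hr : ((3 : ℝ≥0) : ℝ) = 3 := by norm_num
  rw [hc, hr] at h
  rw [h]
  refine lintegral_congr fun x => ?_
  rw [show (3 : ℝ) = ((3 : ℕ) : ℝ) by norm_num, ENNReal.rpow_natCast]

/-- Tonelli on a box for a real power of the norm. [folklore] -/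
theorem lintegral_lintegral_enorm_rpow_box {X : Type*} [NormedAddCommGroup X] {f : ℝ → (EuclideanSpace ℝ (Fin 3)) → X}
    {T : ℝ} {s : Set (EuclideanSpace ℝ (Fin 3))}
    (hf : AEStronglyMeasurable (uncurry f) ((volume.restrict (Ioo (0 : ℝ) T)).prod
      (volume.restrict s))) (p : ℝ) :
    ∫⁻ t in Ioo 0 T, ∫⁻ y in s, ‖f t y‖ₑ ^ p = ∫⁻ z in Ioo 0 T ×ˢ s, ‖f z.1 z.2‖ₑ ^ p := by
  have hprod : (volume.restrict (Ioo (0 : ℝ) T)).prod (volume.restrict s) =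
      volume.restrict (Ioo 0 T ×ˢ s) := by
    rw [Measure.prod_restrict, ← Measure.volume_eq_prod]
  have hF : AEMeasurable (fun z : ℝ × (EuclideanSpace ℝ (Fin 3)) => ‖f z.1 z.2‖ₑ ^ p)
      ((volume.restrict (Ioo (0 : ℝ) T)).prod (volume.restrict s)) :=
    hf.enorm.pow_const _
  rw [← hprod, lintegral_prod _ hF]

/-- Tonelli on a box for a natural power of the norm. [folklore] -/
theorem lintegral_lintegral_enorm_pow_box {X : Type*} [NormedAddCommGroup X] {f : ℝ → (EuclideanSpace ℝ (Fin 3)) → X}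
    {T : ℝ} {s : Set (EuclideanSpace ℝ (Fin 3))}
    (hf : AEStronglyMeasurable (uncurry f) ((volume.restrict (Ioo (0 : ℝ) T)).prod
      (volume.restrict s))) (n : ℕ) :
    ∫⁻ t in Ioo 0 T, ∫⁻ y in s, ‖f t y‖ₑ ^ n = ∫⁻ z in Ioo 0 T ×ˢ s, ‖f z.1 z.2‖ₑ ^ n := by
  have hprod : (volume.restrict (Ioo (0 : ℝ) T)).prod (volume.restrict s) =
      volume.restrict (Ioo 0 T ×ˢ s) := by
    rw [Measure.prod_restrict, ← Measure.volume_eq_prod]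
  have hF : AEMeasurable (fun z : ℝ × (EuclideanSpace ℝ (Fin 3)) => ‖f z.1 z.2‖ₑ ^ n)
      ((volume.restrict (Ioo (0 : ℝ) T)).prod (volume.restrict s)) :=
    hf.enorm.pow_const _
  rw [← hprod, lintegral_prod _ hF]

/-- The pressure of a local Leray solution is a.e.-strongly measurable on the boxes
`(0, T) × s`. [folklore] -/
theorem IsLocalLeraySolution.aestronglyMeasurable_pressure_box
    (hv : IsLocalLeraySolution ν u₀ v π) (T : ℝ) (s : Set (EuclideanSpace ℝ (Fin 3))) :
    AEStronglyMeasurable (uncurry π)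
      ((volume.restrict (Ioo (0 : ℝ) T)).prod (volume.restrict s)) := by
  rw [Measure.prod_restrict, ← Measure.volume_eq_prod]
  have h : AEStronglyMeasurable (uncurry π)
      (volume.restrict (Ioi (0 : ℝ) ×ˢ (univ : Set (EuclideanSpace ℝ (Fin 3))))) :=
    hv.suitable.distributional.2.2.1.aestronglyMeasurable
  exact h.mono_measure
    (Measure.restrict_mono (Set.prod_mono Ioo_subset_Ioi_self (subset_univ _)) le_rfl)

/-- **The mean gauge is in `L^{3/2}(0, T)`.** For a local Leray solution, every centre `x₁`,
radius `r > 0` and `T > 0`, the spatial mean `t ↦ ⨍_{B(x₁, r)} π(t, y) dy` of the pressure is in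
`L^{3/2}(0, T)`: it is measurable by Fubini, and `|⨍_B π(t)|^{3/2} ≤ |B|⁻¹ ∫_B |π(t)|^{3/2}`
(Hölder), whose time integral is finite because `π ∈ L^{3/2}_loc(ℝ³ × [0, ∞))` (Def. 3.2 (1)).
[folklore] -/
theorem IsLocalLeraySolution.memLp_setAverage_pressure (hv : IsLocalLeraySolution ν u₀ v π)
    (x₁ : (EuclideanSpace ℝ (Fin 3))) {r : ℝ} (hr : 0 < r) {T : ℝ} (hT : 0 < T) :
    MemLp (fun t => ⨍ y in ball x₁ r, π t y) (3 / 2 : ℝ≥0∞)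
      (volume.restrict (Ioo (0 : ℝ) T)) := by
  set B : Set (EuclideanSpace ℝ (Fin 3)) := ball x₁ r with hB
  set μt : Measure ℝ := volume.restrict (Ioo (0 : ℝ) T) with hμt
  set μB : Measure (EuclideanSpace ℝ (Fin 3)) := volume.restrict B with hμB
  have hπm : AEStronglyMeasurable (uncurry π) (μt.prod μB) :=
    hv.aestronglyMeasurable_pressure_box T B
  have hV0 : volume B ≠ 0 := (measure_ball_pos volume x₁ hr).ne'
  have hVtop : volume B ≠ ∞ := measure_ball_lt_top.ne
  have hne0 : (3 / 2 : ℝ≥0∞) ≠ 0 := (ENNReal.div_pos_iff.2 ⟨by norm_num, by norm_num⟩).ne'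
  have hnetop : (3 / 2 : ℝ≥0∞) ≠ ∞ := ENNReal.div_ne_top (by norm_num) (by norm_num)
  have h1le : (1 : ℝ≥0∞) ≤ 3 / 2 := by
    rw [ENNReal.le_div_iff_mul_le (Or.inl (by norm_num)) (Or.inl (by norm_num))]
    norm_num
  -- measurability of the mean
  have hmeas : AEStronglyMeasurable (fun t => ⨍ y in B, π t y) μt := by
    have h1 : AEStronglyMeasurable (fun t => ∫ y in B, π t y) μt := hπm.integral_prod_right'
    have h2 : (fun t => ⨍ y in B, π t y) = fun t => ((volume : Measure (EuclideanSpace ℝ (Fin 3))).real B)⁻¹ •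
        ∫ y in B, π t y := by
      funext t
      rw [setAverage_eq]
    rw [h2]
    exact h1.const_smul (((volume : Measure (EuclideanSpace ℝ (Fin 3))).real B)⁻¹)
  refine ⟨hmeas, ?_⟩
  -- the pointwise bound `|⨍_B π(t)|^{3/2} ≤ κ ∫_B |π(t)|^{3/2}`
  have hslice : ∀ᵐ t ∂μt, AEStronglyMeasurable (π t) μB := hπm.prodMk_left
  set κ : ℝ≥0∞ := (‖((volume : Measure (EuclideanSpace ℝ (Fin 3))).real B)⁻¹‖ₑ * (volume B) ^ (1 / 3 : ℝ)) ^ (3 / 2 : ℝ)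
    with hκ
  have hκtop : κ ≠ ∞ := ENNReal.rpow_ne_top_of_nonneg (by norm_num)
    (ENNReal.mul_ne_top enorm_ne_top (ENNReal.rpow_ne_top_of_nonneg (by norm_num) hVtop))
  have hpt : ∀ᵐ t ∂μt, ‖⨍ y in B, π t y‖ₑ ^ (3 / 2 : ℝ) ≤
      κ * ∫⁻ y in B, ‖π t y‖ₑ ^ (3 / 2 : ℝ) := by
    filter_upwards [hslice] with t ht
    have h1 : ‖⨍ y in B, π t y‖ₑ ≤ ‖((volume : Measure (EuclideanSpace ℝ (Fin 3))).real B)⁻¹‖ₑ *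
        (volume B) ^ (1 / 3 : ℝ) * eLpNorm (π t) (3 / 2) μB := by
      rw [setAverage_eq, enorm_smul, mul_assoc]
      gcongr
      calc ‖∫ y in B, π t y‖ₑ ≤ ∫⁻ y in B, ‖π t y‖ₑ := enorm_integral_le_lintegral_enorm _
        _ = eLpNorm (π t) 1 μB := by rw [eLpNorm_one_eq_lintegral_enorm]
        _ ≤ eLpNorm (π t) (3 / 2) μB *
            μB univ ^ (1 / (1 : ℝ≥0∞).toReal - 1 / (3 / 2 : ℝ≥0∞).toReal) :=
          eLpNorm_le_eLpNorm_mul_rpow_measure_univ h1le ht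
        _ = (volume B) ^ (1 / 3 : ℝ) * eLpNorm (π t) (3 / 2) μB := by
          rw [hμB, Measure.restrict_apply_univ, ENNReal.toReal_one, ennreal_toReal_three_halves,
            mul_comm]
          norm_num
    calc ‖⨍ y in B, π t y‖ₑ ^ (3 / 2 : ℝ)
        ≤ (‖((volume : Measure (EuclideanSpace ℝ (Fin 3))).real B)⁻¹‖ₑ * (volume B) ^ (1 / 3 : ℝ) *
            eLpNorm (π t) (3 / 2) μB) ^ (3 / 2 : ℝ) := ENNReal.rpow_le_rpow h1 (by norm_num)
      _ = κ * eLpNorm (π t) (3 / 2) μB ^ (3 / 2 : ℝ) := by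
          rw [hκ, ENNReal.mul_rpow_of_nonneg _ _ (by norm_num)]
      _ = κ * ∫⁻ y in B, ‖π t y‖ₑ ^ (3 / 2 : ℝ) := by
          rw [eLpNorm_rpow_three_halves_eq]
  -- finiteness
  rw [eLpNorm_eq_lintegral_rpow_enorm_toReal hne0 hnetop, ennreal_toReal_three_halves]
  refine ENNReal.rpow_lt_top_of_nonneg (by norm_num) (ne_of_lt ?_)
  calc ∫⁻ t, ‖⨍ y in B, π t y‖ₑ ^ (3 / 2 : ℝ) ∂μt
      ≤ ∫⁻ t, κ * (∫⁻ y in B, ‖π t y‖ₑ ^ (3 / 2 : ℝ)) ∂μt := lintegral_mono_ae hpt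
    _ = κ * ∫⁻ z in Ioo 0 T ×ˢ B, ‖π z.1 z.2‖ₑ ^ (3 / 2 : ℝ) := by
        rw [lintegral_const_mul' _ _ hκtop, hμt, lintegral_lintegral_enorm_rpow_box hπm]
    _ < ∞ := by
        refine ENNReal.mul_lt_top hκtop.lt_top ?_
        exact (lintegral_mono_set (Set.prod_mono Subset.rfl ball_subset_closedBall)).trans_lt
          (hv.pressure T hT _ (isCompact_closedBall x₁ r))

/-- **Dp from the oscillation estimate.** Suppose that every local Leray solution `(v, π)`
with `L³` divergence-free datum satisfies, for some constant `C` and every centre `x₁`, for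
a.e. `t > 0`, the slice estimate
`‖π(t) - ⨍_{B(x₁,3/2)} π(t)‖_{L^{3/2}(B(x₁,3/2))}
  ≤ C ‖v(t)‖²_{L³(B(x₁,11/2))} + C ∫_{|y-x₁| ≥ 3/2} |v(t,y)|² |y-x₁|⁻⁴ dy`
(the Calderón–Zygmund and far-field bounds of Kang–Miura–Tsai's proof of Lemma 3.4,
arXiv:1812.10509 App. 1 p. 18, in the mean gauge). Then the pressure part **Dp** of the
Kikuchi–Seregin decay holds, with the gauge `c_{x₀}(t) = ⨍_{B(x₀,3/2)} π(t)`: it is in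
`L^{3/2}(0, T)` (`memLp_setAverage_pressure`), and
`∫₀ᵀ ∫_{B(x₀,3/2)} |π - c_{x₀}|^{3/2} ≤ 2^{1/2} C^{3/2} (∫₀ᵀ∫_{B(x₀,11/2)} |v|³ + ∫₀ᵀ far^{3/2}) → 0`
by the velocity decay (`IsLocalLeraySolution.tendsto_lintegral_cube_cocompact`) and the
far-field decay (`IsLocalLeraySolution.tendsto_lintegral_farField_rpow`).
[cite: KangMiuraTsai2020, Lemma 3.3 (δ_R term) with App. 1 proof of Lemma 3.4 p. 18, arXiv:1812.10509] -/
theorem leray_solution_pressure_decay_of_oscillation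
    (hOsc : ∀ (u₀ : (EuclideanSpace ℝ (Fin 3)) → (EuclideanSpace ℝ (Fin 3))) (v : ℝ → (EuclideanSpace ℝ (Fin 3)) → (EuclideanSpace ℝ (Fin 3))) (π : ℝ → (EuclideanSpace ℝ (Fin 3)) → ℝ),
      IsLocalLeraySolution 1 u₀ v π → ∃ C : ℝ≥0, ∀ x₁ : (EuclideanSpace ℝ (Fin 3)),
        ∀ᵐ t ∂(volume.restrict (Ioi (0 : ℝ))),
          eLpNorm (fun y => π t y - ⨍ y' in ball x₁ (3 / 2), π t y') (3 / 2 : ℝ≥0∞)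
              (volume.restrict (ball x₁ (3 / 2))) ≤
            C * eLpNorm (v t) 3 (volume.restrict (ball x₁ (11 / 2))) ^ 2 +
              C * ∫⁻ y in (ball x₁ (3 / 2))ᶜ,
                ‖v t y‖ₑ ^ 2 * ENNReal.ofReal ((‖y - x₁‖ ^ 4)⁻¹)) :
    leray_solution_pressure_decay := by
  intro u₀ _h3 _hdiv v π hv
  obtain ⟨C, hC⟩ := hOsc u₀ v π hv
  refine ⟨fun x₁ t => ⨍ y' in ball x₁ (3 / 2), π t y', fun x₁ T hT =>
    hv.memLp_setAverage_pressure x₁ (by norm_num) hT, fun T hT => ?_⟩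
  set μt : Measure ℝ := volume.restrict (Ioo (0 : ℝ) T) with hμt
  set A : ℝ≥0∞ := (2 : ℝ≥0∞) ^ (1 / 2 : ℝ) * (C : ℝ≥0∞) ^ (3 / 2 : ℝ) with hA
  have hAtop : A ≠ ∞ := ENNReal.mul_ne_top (ENNReal.rpow_ne_top_of_nonneg (by norm_num)
    ENNReal.ofNat_ne_top) (ENNReal.rpow_ne_top_of_nonneg (by norm_num) ENNReal.coe_ne_top)
  -- the bound at one centre
  have key : ∀ x₁ : (EuclideanSpace ℝ (Fin 3)), ∫⁻ z in Ioo 0 T ×ˢ ball x₁ (3 / 2),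
      ‖π z.1 z.2 - ⨍ y' in ball x₁ (3 / 2), π z.1 y'‖ₑ ^ (3 / 2 : ℝ) ≤
      A * ((∫⁻ z in Ioo 0 T ×ˢ ball x₁ (11 / 2), ‖v z.1 z.2‖ₑ ^ (3 : ℕ)) +
        ∫⁻ t in Ioo 0 T, (∫⁻ y in (ball x₁ (3 / 2))ᶜ,
          ‖v t y‖ₑ ^ 2 * ENNReal.ofReal ((‖y - x₁‖ ^ 4)⁻¹)) ^ (3 / 2 : ℝ)) := by
    intro x₁
    set B : Set (EuclideanSpace ℝ (Fin 3)) := ball x₁ (3 / 2) with hB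
    set B' : Set (EuclideanSpace ℝ (Fin 3)) := ball x₁ (11 / 2) with hB'
    set c : ℝ → ℝ := fun t => ⨍ y' in B, π t y' with hc
    set far : ℝ → ℝ≥0∞ := fun t => ∫⁻ y in Bᶜ,
      ‖v t y‖ₑ ^ 2 * ENNReal.ofReal ((‖y - x₁‖ ^ 4)⁻¹) with hfar
    have hcm : AEStronglyMeasurable c μt := (hv.memLp_setAverage_pressure x₁
      (by norm_num : (0 : ℝ) < 3 / 2) hT).1
    have hπm : AEStronglyMeasurable (uncurry π) (μt.prod (volume.restrict B)) :=
      hv.aestronglyMeasurable_pressure_box T B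
    have hvm : AEStronglyMeasurable (uncurry v) (μt.prod (volume.restrict B')) :=
      hv.aestronglyMeasurable_box T B'
    -- Tonelli on the left
    have hdm : AEStronglyMeasurable (uncurry fun t y => π t y - c t)
        (μt.prod (volume.restrict B)) := hπm.sub hcm.comp_fst
    have hL : ∫⁻ z in Ioo 0 T ×ˢ B, ‖π z.1 z.2 - c z.1‖ₑ ^ (3 / 2 : ℝ) =
        ∫⁻ t in Ioo 0 T, ∫⁻ y in B, ‖π t y - c t‖ₑ ^ (3 / 2 : ℝ) :=
      (lintegral_lintegral_enorm_rpow_box hdm (3 / 2)).symm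
    -- the slice inequality, a.e. in `t`
    have hslice : ∀ᵐ t ∂μt, ∫⁻ y in B, ‖π t y - c t‖ₑ ^ (3 / 2 : ℝ) ≤
        A * ((∫⁻ y in B', ‖v t y‖ₑ ^ (3 : ℕ)) + far t ^ (3 / 2 : ℝ)) := by
      have h1 := ae_restrict_of_ae_restrict_of_subset
        (Ioo_subset_Ioi_self : Ioo (0 : ℝ) T ⊆ Ioi 0) (hC x₁)
      filter_upwards [h1] with t ht
      rw [← eLpNorm_rpow_three_halves_eq (volume.restrict B) (fun y => π t y - c t)]
      have e3 : (eLpNorm (v t) 3 (volume.restrict B') ^ 2) ^ (3 / 2 : ℝ) =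
          ∫⁻ y in B', ‖v t y‖ₑ ^ (3 : ℕ) := by
        rw [← eLpNorm_rpow_three_eq, show ((eLpNorm (v t) 3 (volume.restrict B')) ^ 2) =
          (eLpNorm (v t) 3 (volume.restrict B')) ^ (2 : ℝ) from (ENNReal.rpow_two _).symm,
          ← ENNReal.rpow_mul]
        norm_num
      calc eLpNorm (fun y => π t y - c t) (3 / 2) (volume.restrict B) ^ (3 / 2 : ℝ)
          ≤ ((C : ℝ≥0∞) * eLpNorm (v t) 3 (volume.restrict B') ^ 2 + C * far t) ^ (3 / 2 : ℝ) :=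
            ENNReal.rpow_le_rpow ht (by norm_num)
        _ ≤ (2 : ℝ≥0∞) ^ ((3 / 2 : ℝ) - 1) *
            (((C : ℝ≥0∞) * eLpNorm (v t) 3 (volume.restrict B') ^ 2) ^ (3 / 2 : ℝ) +
              ((C : ℝ≥0∞) * far t) ^ (3 / 2 : ℝ)) :=
            ENNReal.rpow_add_le_mul_rpow_add_rpow _ _ (by norm_num)
        _ = A * ((∫⁻ y in B', ‖v t y‖ₑ ^ (3 : ℕ)) + far t ^ (3 / 2 : ℝ)) := by
            rw [ENNReal.mul_rpow_of_nonneg _ _ (by norm_num),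
              ENNReal.mul_rpow_of_nonneg _ _ (by norm_num), e3, hA,
              show (3 / 2 : ℝ) - 1 = 1 / 2 by norm_num]
            ring
    -- integrate in time
    have hcube_meas : AEMeasurable (fun t => ∫⁻ y in B', ‖v t y‖ₑ ^ (3 : ℕ)) μt :=
      (hvm.enorm.pow_const _).lintegral_prod_right'
    calc ∫⁻ z in Ioo 0 T ×ˢ B, ‖π z.1 z.2 - c z.1‖ₑ ^ (3 / 2 : ℝ)
        = ∫⁻ t in Ioo 0 T, ∫⁻ y in B, ‖π t y - c t‖ₑ ^ (3 / 2 : ℝ) := hL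
      _ ≤ ∫⁻ t in Ioo 0 T, A * ((∫⁻ y in B', ‖v t y‖ₑ ^ (3 : ℕ)) + far t ^ (3 / 2 : ℝ)) :=
          lintegral_mono_ae hslice
      _ = A * ((∫⁻ t in Ioo 0 T, ∫⁻ y in B', ‖v t y‖ₑ ^ (3 : ℕ)) +
            ∫⁻ t in Ioo 0 T, far t ^ (3 / 2 : ℝ)) := by
          rw [lintegral_const_mul' _ _ hAtop, lintegral_add_left' hcube_meas]
      _ = _ := by rw [lintegral_lintegral_enorm_pow_box hvm 3]
  -- the two limits
  have hcube := hv.tendsto_lintegral_cube_cocompact (11 / 2) T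
  have hfarlim := hv.tendsto_lintegral_farField_rpow (R := 3 / 2) (by norm_num) hT
  have hsum := hcube.add hfarlim
  rw [add_zero] at hsum
  have hlim := ENNReal.Tendsto.const_mul hsum (Or.inr hAtop) (a := A)
  rw [mul_zero] at hlim
  exact tendsto_of_tendsto_of_tendsto_of_le_of_le tendsto_const_nhds hlim (fun _ => zero_le) key

/-- **D from the oscillation estimate**: the Kikuchi–Seregin decay `leray_solution_ckn_decay`
follows from the slice estimate of `leray_solution_pressure_decay_of_oscillation` (pressure
part) and the tree's velocity decay (`leray_solution_ckn_decay_of_pressure_decay`).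
[cite: KangMiuraTsai2020, Lemma 3.3 with Lemma 3.4, arXiv:1812.10509 §3] -/
theorem leray_solution_ckn_decay_of_oscillation
    (hOsc : ∀ (u₀ : (EuclideanSpace ℝ (Fin 3)) → (EuclideanSpace ℝ (Fin 3))) (v : ℝ → (EuclideanSpace ℝ (Fin 3)) → (EuclideanSpace ℝ (Fin 3))) (π : ℝ → (EuclideanSpace ℝ (Fin 3)) → ℝ),
      IsLocalLeraySolution 1 u₀ v π → ∃ C : ℝ≥0, ∀ x₁ : (EuclideanSpace ℝ (Fin 3)),
        ∀ᵐ t ∂(volume.restrict (Ioi (0 : ℝ))),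
          eLpNorm (fun y => π t y - ⨍ y' in ball x₁ (3 / 2), π t y') (3 / 2 : ℝ≥0∞)
              (volume.restrict (ball x₁ (3 / 2))) ≤
            C * eLpNorm (v t) 3 (volume.restrict (ball x₁ (11 / 2))) ^ 2 +
              C * ∫⁻ y in (ball x₁ (3 / 2))ᶜ,
                ‖v t y‖ₑ ^ 2 * ENNReal.ofReal ((‖y - x₁‖ ^ 4)⁻¹)) :
    leray_solution_ckn_decay :=
  leray_solution_ckn_decay_of_pressure_decay (leray_solution_pressure_decay_of_oscillation hOsc)

end Reduction

end Literature.Analysis.FluidPDE
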